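import Summits.AtomisticToContinuum.FouriersLaw.Theses.OddSectorIrreversibility
import Literature.Barriers.AtomisticToContinuum.MazurBoundBallisticOpenChain

/-!
# Disproof of `SubBallisticWindow` — findings (crux disprover `cdisprove-stmt-AtomisticToContinuum-14070`, gen 1, cycle 1)

Crux item `stmt-AtomisticToContinuum-14070` =
`Summit.AtomisticToContinuum.FouriersLaw.Theses.OddSectorIrreversibility.SubBallisticWindow` (E2, rank 3 of route
OddSectorIrreversibility rev ≥ 6): for `pinnedChain ω₂ lam β γ` (all four `> 0`), `T > 0`:
`∃ C ∀ N, k₁ ≤ k₂ (k₂+1 ≤ N), τ ≥ 0: ∫ (∫_{(0,τ]} (P⁰_t J_B)(x) dt)² e^{-H(x)/T} dx ≤ C (1+τ) (k₂-k₁) Z`,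
`J_B = ∑_{k₁ ≤ i < k₂} j_i`, `P⁰_t` = the transition kernels of the CLOSED chain `pinnedChain ω₂ lam β 0`, `Z = ∫e^{-H/T}`.

VERDICT (cycle 1, 2026-08-16): **RESISTS.  No kill; a kill needs a BALLISTIC (or superdiffusive) channel in the
equilibrium energy-current fluctuations of a non-integrable pinned chain, growing with `N` at fixed `(ω₂,lam,β,T)` —
nothing of the kind is known in print or found numerically.  Everything cheap is settled below as theorems
(this file is `lean check` rc 0, NO `sorry`).**

What this file establishes (prose only in doc-comments):

* §0 `crux_iff` — read-back in named pieces (`blockCurrent`, `gibbsWeight`, `partitionZ`, `windowedTransport`,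
  `lhs`, `WindowBound`); `Iff.rfl` with the route decl.
* §1 NO JUNK: `closedKernel_eq_dirac` — the closed kernel `(pinnedChain ω₂ lam β 0).transitionKernel N T T t x` is
  the Dirac mass at the constructed Hamiltonian flow `closedFlow t x = chainFlow N x 0 t` (zero friction ⇒ zero
  noise amplitude `√(2·0·T) = 0`; `ω₂ > 0`, `lam, β ≥ 0`), so `(P⁰_t J_B)(x) = J_B(Φ_t x)` (`windowedTransport_eq`).
  Every Bochner junk default in the crux evaluates to `0 ≤ RHS` and can only HELP a prover; none helps a refuter.
* §2 FLOW CALCULUS (sorry-free, reusable by provers of E2/E3/WitnessGlue): `hasDerivAt_closedFlow` (the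
  constructed flow solves Hamilton's equations for `t > 0`, from `pinnedChain_isIntegralSolutionOn_chainFlow` + FTC),
  `hasDerivAt_comp_closedFlow` (`d/dt f∘Φ_t = {H,f}∘Φ_t`), `comp_closedFlow_sub_eq_integral` (FTC along the flow for
  `f ∈ C²`), `hamiltonian_closedFlow` (energy conservation `H∘Φ_τ = H`).
* §3 ENERGY BOOKKEEPING: `poisson_hamiltonian_weightedEnergy` — `{H, ∑_k w_k h_k} = ∑_k (w_{k+1} - w_k) j_k` for ANY
  weight sequence (site energies with bonds split evenly; generalises the catalogue's
  `MazurBoundBallisticOpenChain.poisson_hamiltonian_energyMoment`, `w_k = k`); with the ramp `w_k = min(k,k₂) ∸ k₁`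
  (`blockWeight`, discrete gradient = indicator of the block): **`Q_B(τ)(x) = W_B(Φ_τ x) - W_B(x)` EXACTLY**
  (`windowedTransport_eq_blockEnergy_sub`), `0 ≤ W_B ≤ ℓ·H` (`blockEnergy_nonneg_le`), hence
  `Q_B(τ)² ≤ (ℓ H)²` pointwise (`windowedTransport_sq_le`) and `lhs ≤ ℓ² ∫H²e^{-H/T}` for EVERY `τ`
  (`lhs_le_sq_moment`).
* §3 THE CRUX AT FIXED `N` IS A THEOREM: `windowBound_fixedN` / `subBallisticWindowFixedN_holds` — with the quantifiers
  swapped to `∀ N ∃ C` (`C_N = N·∫H²e^{-H/T}/Z`) the inequality holds for all blocks and ALL windows, for `ω₂ > 0`,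
  `lam, β ≥ 0` — INCLUDING the harmonic corner — and any `γ`, `T > 0`.  Consequences: (i) the ENTIRE content of the
  crux is the `N`-uniformity of `C`; (ii) no finite computation / single `N` can refute it; (iii) large `τ` is
  harmless exactly as the planner claims (the window integral is a bounded energy difference); (iv) any refutation
  must exhibit `sup_{B,τ} lhs/((1+τ)ℓZ) → ∞` along `N → ∞` at FIXED parameters.
* §4 LOAD-BEARING ANALYSIS: `subBallisticWindow_iff_withoutGamma` — `0 < γ` is pure decoration (THEOREM: the body is
  `γ`-free, `windowBound_gamma_irrel` is `Iff.rfl`).  On paper (not formalisable without Gaussian flow calculus):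
  `0 < lam ∧ 0 < β` jointly load-bearing ONLY THROUGH `N`-UNIFORMITY — at `lam = β = 0` the fixed-`N` form still
  holds (§3) but `C_N ≳ c·T²·N` is forced (ballistic phonons: for a block of `ℓ` bonds and `vτ ≲ ℓ`,
  `Var Q_B(τ) ≈ c_T ℓ ⟨v²⟩ τ²`, ratio `≈ c_T⟨v²⟩τ` up to `τ ≍ ℓ/v ≍ N`; NB a SINGLE bond (`ℓ = 1`) satisfies the crux
  bound even in the harmonic chain, `Var Q_i(τ) ≍ τ` — the harmonic violation needs `ℓ → ∞` with `τ ≍ ℓ`; numerics: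
  set E of kit j011175); each of `0 < lam`, `0 < β` SEPARATELY droppable physically (pinned FPU-β / φ⁴-type chains are
  expected diffusive); `0 < ω₂` is used by every flow lemma of the tree (quartic pinning alone would still pin);
  `0 < T`: for `T ≤ 0` all integrals are junk/zero or the weight is not integrable — irrelevant.  Quantifier audit:
  `C` may depend on `(ω₂,lam,β,T)` (∃ after ∀T) — NECESSARY and sufficient to absorb the weak-anharmonicity / low-`T`
  corner (`Literature.Barriers.AtomisticToContinuum.LowTemperatureWeakAnharmonicity`): kinetic theory gives
  `sup_τ Var Q_B(τ)/(ℓτ) ≈ 2κ(T)T²` with the phonon mean free time `τ_mfp(T) → ∞` as `T → 0` entering only `C(T)`.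
* §5 NATURAL STRENGTHENINGS (paper): `(1+τ) ↦ τ` is equivalent given the `N`-uniform static bound `∫J_B²dμ_T ≤ cℓZ`
  (`⟨j_i j_{i'}⟩ = 0` for `|i-i'| ≥ 2`); `C` uniform in `T` is false as `T → ∞` (`κ(T)T² → ∞`, quartic scaling
  `κ ∼ T^{1/4}`) but not cheaply provable; OPEN-kernel variant (baths on) also expected true (through-conduction noise
  `ℓ²·2T²G_Nτ ≍ ℓ κT² τ` for central blocks).  None gives a cheap kill.
* §6 NUMERICS (kit, `--workitem` attached): j011175 (sets A `(1,1,1),T=1` + E harmonic control, `N ≤ 512`,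
  `τ ≤ 4N`), j011177 (B `T = 0.1`, D `lam=β=0.1`), j011180 (C `T=10`, F `ω₂=4`): `R(N,B,τ) = E[Q_B²]/(ℓ(1+τ))` by
  EXACT bookkeeping `Q_B = ΔW_B` (no current quadrature); PENDING at publication — the tables are folded in at the
  next boundary.  Expected: anharmonic sets plateau in `N` (≈ `2κT²`), harmonic control grows `∝ N`.
* §7 WHY IT RESISTS (bottom of file).  §8 TARGETS: none (`payload.targets = []`, no line picked yet).
-/

noncomputable section

open MeasureTheory Filter Topology Set
open scoped NNReal ContDiff
open Literature.MathematicalPhysics.KineticTheory.HeatConduction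
open Literature.Probability.Process

namespace Summit.AtomisticToContinuum.FouriersLaw.Cruxes.SubBallisticWindow.Disproof

open Summit.AtomisticToContinuum.FouriersLaw.Theses.OddSectorIrreversibility

/-! ## §0 Read-back of the crux in named pieces -/

/-- `J_B = ∑_{k₁ ≤ i < k₂} j_i` — the block current of the crux (`let JB`). -/
def blockCurrent (ω₂ lam β γ : ℝ) (N k₁ k₂ : ℕ) (z : PhaseSpace N) : ℝ :=
  ∑ i : Fin N, (if k₁ ≤ i.val ∧ i.val < k₂ then (pinnedChain ω₂ lam β γ).bondCurrent N i z else 0)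

/-- `μ_T = e^{-H/T} dq dp` — the unnormalised Gibbs weight of the crux (`let μT`). -/
def gibbsWeight (ω₂ lam β γ : ℝ) (N : ℕ) (T : ℝ) : Measure (PhaseSpace N) :=
  volume.withDensity fun x => ENNReal.ofReal (Real.exp (-((pinnedChain ω₂ lam β γ).hamiltonian N x) / T))

/-- `Z = ∫ e^{-H/T}` — the partition function on the right-hand side. -/
def partitionZ (ω₂ lam β γ : ℝ) (N : ℕ) (T : ℝ) : ℝ :=
  ∫ x, Real.exp (-((pinnedChain ω₂ lam β γ).hamiltonian N x) / T) ∂volume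

/-- `Q_B(τ)(x) = ∫_{(0,τ]} (P⁰_t J_B)(x) dt` — the windowed block transport through the CLOSED kernels
(`pinnedChain ω₂ lam β 0`, nominal bath temperatures `T, T`). -/
def windowedTransport (ω₂ lam β γ : ℝ) (N k₁ k₂ : ℕ) (T τ : ℝ) (x : PhaseSpace N) : ℝ :=
  ∫ t in Set.Ioc (0 : ℝ) τ, (∫ y, blockCurrent ω₂ lam β γ N k₁ k₂ y
    ∂((pinnedChain ω₂ lam β 0).transitionKernel N T T t.toNNReal x))

/-- The second moment `∫ Q_B(τ)² dμ_T` (left-hand side of the crux). -/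
def lhs (ω₂ lam β γ : ℝ) (N k₁ k₂ : ℕ) (T τ : ℝ) : ℝ :=
  ∫ x, (windowedTransport ω₂ lam β γ N k₁ k₂ T τ x) ^ 2 ∂(gibbsWeight ω₂ lam β γ N T)

/-- The window inequality at one `(C, N, k₁, k₂, τ)`. -/
def WindowBound (ω₂ lam β γ T C : ℝ) (N k₁ k₂ : ℕ) (τ : ℝ) : Prop :=
  lhs ω₂ lam β γ N k₁ k₂ T τ ≤ C * (1 + τ) * ((k₂ : ℝ) - k₁) * partitionZ ω₂ lam β γ N T

/-- Read-back: the crux is `∀ params > 0, ∀ T > 0, ∃ C, ∀ N k₁ k₂ τ, WindowBound`, definitionally. -/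
theorem crux_iff :
    SubBallisticWindow ↔
      ∀ ω₂ lam β γ : ℝ, 0 < ω₂ → 0 < lam → 0 < β → 0 < γ → ∀ T : ℝ, 0 < T → ∃ C : ℝ,
        ∀ N k₁ k₂ : ℕ, k₁ ≤ k₂ → k₂ + 1 ≤ N → ∀ τ : ℝ, 0 ≤ τ → WindowBound ω₂ lam β γ T C N k₁ k₂ τ :=
  Iff.rfl

/-! ## §1 The closed kernel is the Dirac mass at the Hamiltonian flow (no junk) -/

/-- The CLOSED flow `Φ_t(x)`: the constructed pathwise flow of `pinnedChain ω₂ lam β 0` with zero noise. -/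
def closedFlow (ω₂ lam β : ℝ) (N : ℕ) (t : ℝ) (x : PhaseSpace N) : PhaseSpace N :=
  (pinnedChain ω₂ lam β 0).chainFlow N x (fun _ => 0) t

/-- Zero amplitudes give the zero noise path. -/
theorem chainNoise_zero_amp (N : ℕ) (w : WienerPair) : chainNoise N 0 0 w = fun _ => 0 := by
  funext t i
  simp [chainNoise]

/-- At `γ = 0` the solution map ignores the Brownian pair: it is the closed flow. -/
theorem closed_solMap_eq (ω₂ lam β : ℝ) (N : ℕ) (T_L T_R t : ℝ) (x : PhaseSpace N) (w : WienerPair) :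
    (pinnedChain ω₂ lam β 0).solMap N T_L T_R t x w = closedFlow ω₂ lam β N t x := by
  unfold OscillatorChain.solMap closedFlow
  have hγ : (pinnedChain ω₂ lam β 0).γ = 0 := rfl
  simp only [hγ, mul_zero, zero_mul, Real.sqrt_zero, chainNoise_zero_amp]

variable {ω₂ lam β : ℝ}

/-- **Closed kernel = Dirac at the flow** (`ω₂ > 0`, `lam, β ≥ 0`, any nominal temperatures). -/
theorem closedKernel_eq_dirac (hω : 0 < ω₂) (hl : 0 ≤ lam) (hβ : 0 ≤ β) (N : ℕ) (T_L T_R : ℝ)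
    (t : ℝ≥0) (x : PhaseSpace N) :
    (pinnedChain ω₂ lam β 0).transitionKernel N T_L T_R t x = Measure.dirac (closedFlow ω₂ lam β N t x) := by
  rw [pinnedChain_transitionKernel_apply hω hl hβ le_rfl]
  simp_rw [closed_solMap_eq]
  rw [Measure.map_const, measure_univ, one_smul]

/-- Integration against the closed kernel is evaluation along the flow. -/
theorem integral_closedKernel (hω : 0 < ω₂) (hl : 0 ≤ lam) (hβ : 0 ≤ β) (N : ℕ) (T_L T_R : ℝ)
    (t : ℝ≥0) (x : PhaseSpace N) (F : PhaseSpace N → ℝ) :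
    ∫ y, F y ∂((pinnedChain ω₂ lam β 0).transitionKernel N T_L T_R t x) = F (closedFlow ω₂ lam β N t x) := by
  rw [closedKernel_eq_dirac hω hl hβ, integral_dirac]

/-- Honest form of the windowed transport: `Q_B(τ)(x) = ∫_{(0,τ]} J_B(Φ_t x) dt`. -/
theorem windowedTransport_eq (hω : 0 < ω₂) (hl : 0 ≤ lam) (hβ : 0 ≤ β) (γ : ℝ) (N k₁ k₂ : ℕ) (T τ : ℝ)
    (x : PhaseSpace N) :
    windowedTransport ω₂ lam β γ N k₁ k₂ T τ x =
      ∫ t in Set.Ioc (0 : ℝ) τ, blockCurrent ω₂ lam β γ N k₁ k₂ (closedFlow ω₂ lam β N t x) := by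
  unfold windowedTransport
  simp_rw [integral_closedKernel hω hl hβ]
  refine setIntegral_congr_fun measurableSet_Ioc fun t ht => ?_
  rw [Real.coe_toNNReal _ ht.1.le]


/-! ## §2 Flow calculus of the closed chain: ODE, chain rule, FTC, energy conservation -/

section FlowCalculus

variable (hω : 0 < ω₂) (hl : 0 ≤ lam) (hβ : 0 ≤ β) (N : ℕ)
include hω hl hβ

omit hω hl hβ in
/-- `Φ_0 = id`. -/
theorem closedFlow_zero (x : PhaseSpace N) : closedFlow ω₂ lam β N 0 x = x := by
  unfold closedFlow
  rw [pinnedChain_chainFlow_of_nonpos ω₂ lam β 0 N x continuous_const le_rfl]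
  simp

/-- The closed flow is continuous in time. -/
theorem continuous_closedFlow (x : PhaseSpace N) : Continuous fun t => closedFlow ω₂ lam β N t x := by
  unfold closedFlow
  exact pinnedChain_continuous_chainFlow hω hl hβ le_rfl N x continuous_const

/-- **The closed flow solves Hamilton's equations**: `d/dt Φ_t(x) = Y(Φ_t(x))` for `t > 0`, `Y` the
drift of `pinnedChain ω₂ lam β 0` (no friction). -/
theorem hasDerivAt_closedFlow (x : PhaseSpace N) {t : ℝ} (ht : 0 < t) :
    HasDerivAt (fun s => closedFlow ω₂ lam β N s x)
      ((pinnedChain ω₂ lam β 0).drift N (closedFlow ω₂ lam β N t x)) t := by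
  set P := pinnedChain ω₂ lam β 0 with hP
  have hsol := pinnedChain_isIntegralSolutionOn_chainFlow hω hl hβ le_rfl N x
    (continuous_const : Continuous fun _ : ℝ => (0 : Fin N → ℝ)) (t + 1)
  have hcont : Continuous fun s => P.drift N (closedFlow ω₂ lam β N s x) :=
    (pinnedChain_contDiff_drift ω₂ lam β 0 N (n := 0)).continuous.comp (continuous_closedFlow hω hl hβ N x)
  have hG : HasDerivAt (fun s => x + ∫ u in (0 : ℝ)..s, P.drift N (closedFlow ω₂ lam β N u x))
      (P.drift N (closedFlow ω₂ lam β N t x)) t := by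
    have h := intervalIntegral.integral_hasDerivAt_right (hcont.intervalIntegrable 0 t)
      (hcont.stronglyMeasurableAtFilter volume (𝓝 t)) hcont.continuousAt
    exact h.const_add x
  refine hG.congr_of_eventuallyEq ?_
  have hmem : Ioo 0 (t + 1) ∈ 𝓝 t := Ioo_mem_nhds ht (by linarith)
  filter_upwards [hmem] with s hs
  have h := hsol s ⟨hs.1.le, hs.2.le⟩
  have hf : OscillatorChain.forcing x (fun _ : ℝ => (0 : Fin N → ℝ)) s = x := by
    simp [OscillatorChain.forcing]
  rw [hf] at h
  exact h

omit hω hl hβ in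
/-- `Y·∇f = {H, f}` for the frictionless chain (generator at `γ = 0` is the Poisson bracket). -/
theorem fderiv_drift_eq_poisson {f : PhaseSpace N → ℝ} (hf : Differentiable ℝ f) (y : PhaseSpace N) :
    fderiv ℝ f y ((pinnedChain ω₂ lam β 0).drift N y) =
      poisson ((pinnedChain ω₂ lam β 0).hamiltonian N) f y := by
  have h1 := (pinnedChain ω₂ lam β 0).generator_eq_fderiv_drift_add N 0 0 hf y
  have h2 := Literature.Barriers.AtomisticToContinuum.OpenChain.generator_eq_poisson_of_gamma_eq_zero
    (pinnedChain ω₂ lam β 0) rfl N 0 0 f y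
  have hγ : (pinnedChain ω₂ lam β 0).γ = 0 := rfl
  rw [hγ, zero_mul, add_zero] at h1
  rw [← h1, h2]

/-- **Chain rule along the closed flow**: `d/dt f(Φ_t x) = {H, f}(Φ_t x)` for differentiable `f`, `t > 0`. -/
theorem hasDerivAt_comp_closedFlow {f : PhaseSpace N → ℝ} (hf : Differentiable ℝ f) (x : PhaseSpace N)
    {t : ℝ} (ht : 0 < t) :
    HasDerivAt (fun s => f (closedFlow ω₂ lam β N s x))
      (poisson ((pinnedChain ω₂ lam β 0).hamiltonian N) f (closedFlow ω₂ lam β N t x)) t := by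
  have h := (hf (closedFlow ω₂ lam β N t x)).hasFDerivAt.comp_hasDerivAt t
    (hasDerivAt_closedFlow hω hl hβ N x ht)
  rw [fderiv_drift_eq_poisson N hf] at h
  exact h

/-- **FTC along the closed flow**: `f(Φ_τ x) - f(x) = ∫₀^τ {H, f}(Φ_t x) dt` for `f ∈ C²`, `τ ≥ 0`. -/
theorem comp_closedFlow_sub_eq_integral {f : PhaseSpace N → ℝ} (hf : ContDiff ℝ 2 f) (x : PhaseSpace N)
    {τ : ℝ} (hτ : 0 ≤ τ) :
    f (closedFlow ω₂ lam β N τ x) - f x =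
      ∫ t in (0 : ℝ)..τ, poisson ((pinnedChain ω₂ lam β 0).hamiltonian N) f (closedFlow ω₂ lam β N t x) := by
  have hfd : Differentiable ℝ f := hf.differentiable (by norm_num)
  have hHc : ContDiff ℝ 2 ((pinnedChain ω₂ lam β 0).hamiltonian N) := pinnedChain_contDiff_hamiltonian ω₂ lam β 0 N
  have hpc : Continuous (poisson ((pinnedChain ω₂ lam β 0).hamiltonian N) f) :=
    (differentiable_poisson hHc hf).continuous
  have hcont : ContinuousOn (fun s => f (closedFlow ω₂ lam β N s x)) (Icc 0 τ) :=
    (hfd.continuous.comp (continuous_closedFlow hω hl hβ N x)).continuousOn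
  have hderiv : ∀ s ∈ Ioo 0 τ, HasDerivAt (fun s => f (closedFlow ω₂ lam β N s x))
      (poisson ((pinnedChain ω₂ lam β 0).hamiltonian N) f (closedFlow ω₂ lam β N s x)) s :=
    fun s hs => hasDerivAt_comp_closedFlow hω hl hβ N hfd x hs.1
  have hint : IntervalIntegrable (fun s => poisson ((pinnedChain ω₂ lam β 0).hamiltonian N) f
      (closedFlow ω₂ lam β N s x)) volume 0 τ :=
    (hpc.comp (continuous_closedFlow hω hl hβ N x)).intervalIntegrable 0 τ
  have h := intervalIntegral.integral_eq_sub_of_hasDerivAt_of_le hτ hcont hderiv hint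
  rw [h, closedFlow_zero N x]

/-- **Energy conservation** along the closed flow: `H(Φ_τ x) = H(x)` for `τ ≥ 0`. -/
theorem hamiltonian_closedFlow (x : PhaseSpace N) {τ : ℝ} (hτ : 0 ≤ τ) :
    (pinnedChain ω₂ lam β 0).hamiltonian N (closedFlow ω₂ lam β N τ x) =
      (pinnedChain ω₂ lam β 0).hamiltonian N x := by
  have h := comp_closedFlow_sub_eq_integral hω hl hβ N (pinnedChain_contDiff_hamiltonian ω₂ lam β 0 N) x hτ
  simp only [poisson_self, intervalIntegral.integral_zero] at h
  linarith

end FlowCalculus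


/-! ## §3a Weighted site energies and their Poisson bracket with `H`: `{H, W_w} = ∑_k (w_{k+1} - w_k) j_k` -/

section Weighted

variable (P : OscillatorChain) {N : ℕ}

/-- Weighted site energies `W_w = ∑_k w_k h_k`, `h_k = p_k²/2 + U(q_k) + ½V(q_{k+1}-q_k) + ½V(q_k-q_{k-1})`
(bond energies split evenly), for a weight sequence `w : ℕ → ℝ`; written as
`∑_k w_k (p_k²/2 + U(q_k)) + ∑_{l = k+1} ((w_k + w_l)/2) V(q_l - q_k)`. -/
def weightedEnergy (w : ℕ → ℝ) (N : ℕ) (x : PhaseSpace N) : ℝ :=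
  (∑ k : Fin N, w k.val * (x.2 k ^ 2 / 2 + P.U (x.1 k))) +
    ∑ k : Fin N, ∑ l : Fin N,
      if l.val = k.val + 1 then ((w k.val + w l.val) / 2) * P.V (x.1 l - x.1 k) else 0

/-- `∂_{p_i} W_w = w_i p_i`. -/
theorem partialP_weightedEnergy (w : ℕ → ℝ) (i : Fin N) (x : PhaseSpace N) :
    partialP i (weightedEnergy P w N) x = w i.val * x.2 i := by
  unfold partialP weightedEnergy
  have h1 : HasDerivAt (fun t : ℝ => ∑ k : Fin N,
      w k.val * ((Function.update x.2 i t k) ^ 2 / 2 + P.U (x.1 k)))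
      (∑ k : Fin N, if k = i then w i.val * x.2 i else 0) (x.2 i) := by
    apply HasDerivAt.fun_sum
    intro k _
    by_cases hk : k = i
    · subst hk
      simp only [Function.update_self, if_true]
      have h' : HasDerivAt (fun t : ℝ => t ^ 2 / 2 + P.U (x.1 k)) (x.2 k) (x.2 k) := by
        have h := ((hasDerivAt_pow 2 (x.2 k)).div_const 2).add_const (P.U (x.1 k))
        have he : ((2 : ℕ) : ℝ) * x.2 k ^ (2 - 1) / 2 = x.2 k := by norm_num
        rwa [he] at h
      exact h'.const_mul _
    · simp only [Function.update_of_ne hk, hk, if_false]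
      exact hasDerivAt_const _ _
  have h2 : HasDerivAt (fun _ : ℝ => ∑ k : Fin N, ∑ l : Fin N,
      if l.val = k.val + 1 then ((w k.val + w l.val) / 2) * P.V (x.1 l - x.1 k) else 0) 0 (x.2 i) :=
    hasDerivAt_const _ _
  have h := h1.add h2
  simp only [Finset.sum_ite_eq', Finset.mem_univ, if_true, add_zero] at h
  exact h.deriv

/-- Closed form of `∂_{q_i} W_w`. -/
def dWeightedEnergy (w : ℕ → ℝ) (N : ℕ) (i : Fin N) (q : Fin N → ℝ) : ℝ :=
  w i.val * deriv P.U (q i) + ∑ k : Fin N, ∑ l : Fin N,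
    if l.val = k.val + 1 then
      ((w k.val + w l.val) / 2) * deriv P.V (q l - q k) *
        ((if l = i then 1 else 0) - (if k = i then 1 else 0)) else 0

/-- `∂_{q_i} W_w = dWeightedEnergy` for differentiable potentials. -/
theorem partialQ_weightedEnergy (hU : Differentiable ℝ P.U) (hV : Differentiable ℝ P.V)
    (w : ℕ → ℝ) (i : Fin N) (x : PhaseSpace N) :
    partialQ i (weightedEnergy P w N) x = dWeightedEnergy P w N i x.1 := by
  unfold partialQ weightedEnergy dWeightedEnergy
  have h1 : HasDerivAt (fun t : ℝ => ∑ k : Fin N,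
      w k.val * (x.2 k ^ 2 / 2 + P.U (Function.update x.1 i t k)))
      (∑ k : Fin N, if k = i then w i.val * deriv P.U (x.1 i) else 0) (x.1 i) := by
    apply HasDerivAt.fun_sum
    intro k _
    by_cases hk : k = i
    · subst hk
      simp only [Function.update_self, if_true]
      exact (((hU _).hasDerivAt).const_add _).const_mul _
    · simp only [Function.update_of_ne hk, hk, if_false]
      exact hasDerivAt_const _ _
  have h2 : HasDerivAt (fun t : ℝ => ∑ k : Fin N, ∑ l : Fin N,
      if l.val = k.val + 1 then ((w k.val + w l.val) / 2) * P.V (Function.update x.1 i t l -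
        Function.update x.1 i t k) else 0)
      (∑ k : Fin N, ∑ l : Fin N, if l.val = k.val + 1 then
        ((w k.val + w l.val) / 2) * deriv P.V (x.1 l - x.1 k) *
          ((if l = i then 1 else 0) - (if k = i then 1 else 0)) else 0) (x.1 i) := by
    refine HasDerivAt.fun_sum fun k _ => HasDerivAt.fun_sum fun l _ => ?_
    by_cases hlk : l.val = k.val + 1
    · simp only [if_pos hlk]
      have ha : HasDerivAt (fun t => Function.update x.1 i t l - Function.update x.1 i t k)
          ((if l = i then 1 else 0) - (if k = i then 1 else 0)) (x.1 i) := by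
        refine HasDerivAt.sub ?_ ?_
        · by_cases hl : l = i
          · subst hl; simp only [Function.update_self, if_true]; exact hasDerivAt_id _
          · simp only [Function.update_of_ne hl, hl, if_false]; exact hasDerivAt_const _ _
        · by_cases hk : k = i
          · subst hk; simp only [Function.update_self, if_true]; exact hasDerivAt_id _
          · simp only [Function.update_of_ne hk, hk, if_false]; exact hasDerivAt_const _ _
      have hcomp := ((hV _).hasDerivAt).comp (x.1 i) ha
      have heval : Function.update x.1 i (x.1 i) l - Function.update x.1 i (x.1 i) k =
          x.1 l - x.1 k := by simp
      rw [heval] at hcomp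
      have := hcomp.const_mul ((w k.val + w l.val) / 2)
      rw [← mul_assoc] at this
      exact this
    · simp only [hlk, if_false]
      exact hasDerivAt_const _ _
  have h := h1.add h2
  simp only [Finset.sum_ite_eq', Finset.mem_univ, if_true] at h
  exact h.deriv

/-- **`{H, W_w} = ∑_k (w_{k+1} - w_k) j_k`**: the Poisson bracket of the Hamiltonian with the weighted
site energies is the weighted sum of bond currents with the DISCRETE GRADIENT of the weights (local
energy balance `ḣ_k = j_{k-1} - j_k` summed by parts; free ends). Generalises
`poisson_hamiltonian_energyMoment` (`w_k = k`). -/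
theorem poisson_hamiltonian_weightedEnergy (hU : Differentiable ℝ P.U) (hV : Differentiable ℝ P.V)
    (w : ℕ → ℝ) (N : ℕ) (x : PhaseSpace N) :
    poisson (P.hamiltonian N) (weightedEnergy P w N) x =
      ∑ k : Fin N, (w (k.val + 1) - w k.val) * P.bondCurrent N k x := by
  unfold poisson
  simp only [P.partialP_hamiltonian, P.partialQ_hamiltonian_eq_dPotential hU hV,
    partialP_weightedEnergy P, partialQ_weightedEnergy P hU hV]
  have key : ∀ i : Fin N,
      x.2 i * dWeightedEnergy P w N i x.1 - P.dPotential N i x.1 * (w i.val * x.2 i) =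
        ∑ k : Fin N, ∑ l : Fin N, if l.val = k.val + 1 then
          x.2 i * deriv P.V (x.1 l - x.1 k) * (((w k.val + w l.val) / 2 - w i.val) *
            ((if l = i then 1 else 0) - (if k = i then 1 else 0))) else 0 := by
    intro i
    unfold dWeightedEnergy OscillatorChain.dPotential
    set A := ∑ k : Fin N, ∑ l : Fin N, (if l.val = k.val + 1 then
      ((w k.val + w l.val) / 2) * deriv P.V (x.1 l - x.1 k) *
        ((if l = i then 1 else 0) - (if k = i then 1 else 0)) else 0) with hA
    set B := ∑ k : Fin N, ∑ l : Fin N, (if l.val = k.val + 1 then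
      deriv P.V (x.1 l - x.1 k) * ((if l = i then 1 else 0) - (if k = i then 1 else 0))
        else 0) with hB
    have h1 : x.2 i * (w i.val * deriv P.U (x.1 i) + A) -
        (deriv P.U (x.1 i) + B) * (w i.val * x.2 i) =
          x.2 i * A - (w i.val * x.2 i) * B := by ring
    rw [h1, hA, hB, Finset.mul_sum, Finset.mul_sum, ← Finset.sum_sub_distrib]
    refine Finset.sum_congr rfl fun k _ => ?_
    rw [Finset.mul_sum, Finset.mul_sum, ← Finset.sum_sub_distrib]
    refine Finset.sum_congr rfl fun l _ => ?_
    split_ifs <;> ring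
  simp only [key]
  rw [Finset.sum_comm]
  refine Finset.sum_congr rfl fun k _ => ?_
  rw [Finset.sum_comm]
  unfold OscillatorChain.bondCurrent
  rw [Finset.mul_sum]
  refine Finset.sum_congr rfl fun l _ => ?_
  rw [Finset.sum_ite_irrel, Finset.sum_const_zero]
  split_ifs with hlk
  · have hl : w l.val = w (k.val + 1) := by rw [hlk]
    simp only [mul_sub, Finset.sum_sub_distrib, mul_ite, mul_one, mul_zero,
      Finset.sum_ite_eq, Finset.mem_univ, if_true]
    rw [hl]
    ring
  · simp

/-- `W_w` is smooth for smooth potentials. -/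
theorem contDiff_weightedEnergy {n : WithTop ℕ∞} (hU : ContDiff ℝ n P.U) (hV : ContDiff ℝ n P.V)
    (w : ℕ → ℝ) (N : ℕ) : ContDiff ℝ n (weightedEnergy P w N) := by
  unfold weightedEnergy
  refine ContDiff.add ?_ ?_
  · refine ContDiff.sum fun k _ => contDiff_const.mul (ContDiff.add ?_ ?_)
    · exact ((contDiff_apply ℝ ℝ k).comp contDiff_snd).pow 2 |>.div_const 2
    · exact hU.comp ((contDiff_apply ℝ ℝ k).comp contDiff_fst)
  · refine ContDiff.sum fun k _ => ContDiff.sum fun l _ => ?_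
    split_ifs
    · exact contDiff_const.mul (hV.comp
        (((contDiff_apply ℝ ℝ l).comp contDiff_fst).sub ((contDiff_apply ℝ ℝ k).comp contDiff_fst)))
    · exact contDiff_const

end Weighted


/-! ## §3b The block: `Q_B(τ) = W_B ∘ Φ_τ - W_B` (energy bookkeeping), `0 ≤ W_B ≤ ℓ·H`, and the crux AT FIXED `N` -/

section Block

/-- The ramp weight of the block of bonds `[k₁, k₂)`: `w_k = #{i ∈ [k₁,k₂) : i < k} = min(k,k₂) ∸ k₁`. -/
def blockWeight (k₁ k₂ : ℕ) (k : ℕ) : ℝ := ((min k k₂ - k₁ : ℕ) : ℝ)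

/-- Discrete gradient of the ramp = indicator of the block. -/
theorem blockWeight_succ_sub (k₁ k₂ k : ℕ) :
    blockWeight k₁ k₂ (k + 1) - blockWeight k₁ k₂ k = if k₁ ≤ k ∧ k < k₂ then 1 else 0 := by
  unfold blockWeight
  split_ifs with h
  · have h1 : min (k + 1) k₂ - k₁ = (min k k₂ - k₁) + 1 := by omega
    rw [h1]; push_cast; ring
  · have h1 : min (k + 1) k₂ - k₁ = min k k₂ - k₁ := by omega
    rw [h1]; ring

/-- `0 ≤ w_k`. -/
theorem blockWeight_nonneg (k₁ k₂ k : ℕ) : 0 ≤ blockWeight k₁ k₂ k := Nat.cast_nonneg _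

/-- `w_k ≤ ℓ = k₂ - k₁`. -/
theorem blockWeight_le {k₁ k₂ : ℕ} (h : k₁ ≤ k₂) (k : ℕ) : blockWeight k₁ k₂ k ≤ (k₂ : ℝ) - k₁ := by
  unfold blockWeight
  rw [← Nat.cast_sub h]
  exact_mod_cast (by omega : min k k₂ - k₁ ≤ k₂ - k₁)

/-- The block energy `W_B = ∑_k w_k h_k` of the block `[k₁, k₂)` (closed chain's potentials). -/
def blockEnergy (ω₂ lam β : ℝ) (N k₁ k₂ : ℕ) : PhaseSpace N → ℝ :=
  weightedEnergy (pinnedChain ω₂ lam β 0) (blockWeight k₁ k₂) N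

/-- The bond currents do not see the bath coupling `γ`. -/
theorem bondCurrent_gamma_irrel (ω₂ lam β γ γ' : ℝ) (N : ℕ) :
    (pinnedChain ω₂ lam β γ).bondCurrent N = (pinnedChain ω₂ lam β γ').bondCurrent N := rfl

/-- The Hamiltonian does not see the bath coupling `γ`. -/
theorem hamiltonian_gamma_irrel (ω₂ lam β γ γ' : ℝ) (N : ℕ) :
    (pinnedChain ω₂ lam β γ).hamiltonian N = (pinnedChain ω₂ lam β γ').hamiltonian N := rfl

/-- `{H, W_B} = J_B`: the block current is the Liouville derivative of the block energy. -/
theorem poisson_hamiltonian_blockEnergy (ω₂ lam β γ : ℝ) (N k₁ k₂ : ℕ) (x : PhaseSpace N) :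
    poisson ((pinnedChain ω₂ lam β 0).hamiltonian N) (blockEnergy ω₂ lam β N k₁ k₂) x =
      blockCurrent ω₂ lam β γ N k₁ k₂ x := by
  unfold blockEnergy blockCurrent
  rw [poisson_hamiltonian_weightedEnergy (pinnedChain ω₂ lam β 0)
    ((pinnedChain_contDiff_U ω₂ lam β 0 (n := 1)).differentiable one_ne_zero)
    ((pinnedChain_contDiff_V ω₂ lam β 0 (n := 1)).differentiable one_ne_zero)]
  refine Finset.sum_congr rfl fun k _ => ?_
  rw [blockWeight_succ_sub, bondCurrent_gamma_irrel ω₂ lam β γ 0]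
  split_ifs <;> simp

variable {ω₂ lam β : ℝ}

/-- `0 ≤ W_B ≤ ℓ · H` pointwise (`ω₂, lam, β ≥ 0`, `k₁ ≤ k₂`, `ℓ = k₂ - k₁`). -/
theorem blockEnergy_nonneg_le (hω : 0 ≤ ω₂) (hl : 0 ≤ lam) (hβ : 0 ≤ β) {N k₁ k₂ : ℕ} (hk : k₁ ≤ k₂)
    (x : PhaseSpace N) :
    0 ≤ blockEnergy ω₂ lam β N k₁ k₂ x ∧
      blockEnergy ω₂ lam β N k₁ k₂ x ≤ ((k₂ : ℝ) - k₁) * (pinnedChain ω₂ lam β 0).hamiltonian N x := by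
  have ha : ∀ k : Fin N, 0 ≤ x.2 k ^ 2 / 2 + (pinnedChain ω₂ lam β 0).U (x.1 k) := fun k => by
    simp only [pinnedChain]; positivity
  have hb : ∀ k l : Fin N, 0 ≤ (pinnedChain ω₂ lam β 0).V (x.1 l - x.1 k) := fun k l => by
    simp only [pinnedChain]; positivity
  have hw0 := blockWeight_nonneg k₁ k₂
  have hw1 := blockWeight_le hk
  set ℓ : ℝ := (k₂ : ℝ) - k₁ with hℓ
  unfold blockEnergy weightedEnergy OscillatorChain.hamiltonian
  constructor
  · refine add_nonneg (Finset.sum_nonneg fun k _ => mul_nonneg (hw0 _) (ha k))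
      (Finset.sum_nonneg fun k _ => Finset.sum_nonneg fun l _ => ?_)
    split_ifs
    · exact mul_nonneg (by linarith [hw0 k.val, hw0 l.val]) (hb k l)
    · exact le_rfl
  · rw [mul_add, Finset.mul_sum, Finset.mul_sum]
    refine add_le_add (Finset.sum_le_sum fun k _ => mul_le_mul_of_nonneg_right (hw1 _) (ha k))
      (Finset.sum_le_sum fun k _ => ?_)
    rw [Finset.mul_sum]
    refine Finset.sum_le_sum fun l _ => ?_
    split_ifs
    · exact mul_le_mul_of_nonneg_right (by linarith [hw1 k.val, hw1 l.val]) (hb k l)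
    · simp

/-- The Gibbs weight as a `withDensity` of an `ℝ≥0`-valued density (definitional). -/
theorem gibbsWeight_eq (γ : ℝ) (N : ℕ) (T : ℝ) :
    gibbsWeight ω₂ lam β γ N T = volume.withDensity fun x =>
      ((Real.toNNReal (Real.exp (-((pinnedChain ω₂ lam β γ).hamiltonian N x) / T)) : ℝ≥0) : ENNReal) := rfl

/-- Integration against the Gibbs weight = weighted Lebesgue integration. -/
theorem integral_gibbsWeight (γ : ℝ) (N : ℕ) (T : ℝ) (g : PhaseSpace N → ℝ) :
    ∫ x, g x ∂(gibbsWeight ω₂ lam β γ N T) =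
      ∫ x, Real.exp (-((pinnedChain ω₂ lam β γ).hamiltonian N x) / T) * g x ∂volume := by
  rw [gibbsWeight_eq, integral_withDensity_eq_integral_smul]
  · refine integral_congr_ae (Filter.Eventually.of_forall fun x => ?_)
    simp only [NNReal.smul_def, smul_eq_mul]
    rw [Real.coe_toNNReal _ (Real.exp_pos _).le]
  · exact (Real.continuous_exp.comp ((pinnedChain_continuous_hamiltonian ω₂ lam β γ N).neg.div_const T)).measurable.real_toNNReal

variable (hω : 0 < ω₂) (hl : 0 ≤ lam) (hβ : 0 ≤ β)
include hω hl hβ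

/-- **Energy bookkeeping**: the windowed block transport of the closed chain is a difference of block
energies along the flow, `Q_B(τ)(x) = W_B(Φ_τ x) - W_B(x)` (`τ ≥ 0`). -/
theorem windowedTransport_eq_blockEnergy_sub (γ : ℝ) (N k₁ k₂ : ℕ) (T : ℝ) {τ : ℝ} (hτ : 0 ≤ τ)
    (x : PhaseSpace N) :
    windowedTransport ω₂ lam β γ N k₁ k₂ T τ x =
      blockEnergy ω₂ lam β N k₁ k₂ (closedFlow ω₂ lam β N τ x) - blockEnergy ω₂ lam β N k₁ k₂ x := by
  have hW : ContDiff ℝ 2 (blockEnergy ω₂ lam β N k₁ k₂) :=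
    contDiff_weightedEnergy _ (pinnedChain_contDiff_U ω₂ lam β 0) (pinnedChain_contDiff_V ω₂ lam β 0) _ N
  rw [windowedTransport_eq hω hl hβ, ← intervalIntegral.integral_of_le hτ,
    comp_closedFlow_sub_eq_integral hω hl hβ N hW x hτ]
  refine intervalIntegral.integral_congr fun t _ => ?_
  exact (poisson_hamiltonian_blockEnergy ω₂ lam β γ N k₁ k₂ _).symm

/-- Pointwise: `Q_B(τ)(x)² ≤ (ℓ · H(x))²` (bookkeeping + energy conservation + `0 ≤ W_B ≤ ℓH`). -/
theorem windowedTransport_sq_le (γ : ℝ) (N : ℕ) {k₁ k₂ : ℕ} (hk : k₁ ≤ k₂) (T : ℝ) {τ : ℝ} (hτ : 0 ≤ τ)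
    (x : PhaseSpace N) :
    (windowedTransport ω₂ lam β γ N k₁ k₂ T τ x) ^ 2 ≤
      (((k₂ : ℝ) - k₁) * (pinnedChain ω₂ lam β γ).hamiltonian N x) ^ 2 := by
  rw [windowedTransport_eq_blockEnergy_sub hω hl hβ γ N k₁ k₂ T hτ, hamiltonian_gamma_irrel ω₂ lam β γ 0]
  obtain ⟨h0, h1⟩ := blockEnergy_nonneg_le hω.le hl hβ hk (closedFlow ω₂ lam β N τ x)
  obtain ⟨h0', h1'⟩ := blockEnergy_nonneg_le hω.le hl hβ hk x (N := N)
  rw [hamiltonian_closedFlow hω hl hβ N x hτ] at h1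
  apply sq_le_sq'
  · linarith
  · linarith

/-- `H² e^{-H/T}` is Lebesgue integrable (`T > 0`). -/
theorem integrable_hamiltonian_sq_mul_exp (γ : ℝ) (N : ℕ) {T : ℝ} (hT : 0 < T) :
    Integrable fun x : PhaseSpace N => Real.exp (-((pinnedChain ω₂ lam β γ).hamiltonian N x) / T) *
      ((pinnedChain ω₂ lam β γ).hamiltonian N x) ^ 2 := by
  have hs : 0 < T⁻¹ / 2 := by positivity
  have hmaj := (pinnedChain_integrable_exp_neg_mul_hamiltonian hω hl hβ γ N hs).const_mul
    (2 * Real.exp (T⁻¹ / 2) / (T⁻¹ / 2) ^ 2)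
  refine hmaj.mono' ?_ (Filter.Eventually.of_forall fun x => ?_)
  · exact ((Real.continuous_exp.comp ((pinnedChain_continuous_hamiltonian ω₂ lam β γ N).neg.div_const T)).mul
      ((pinnedChain_continuous_hamiltonian ω₂ lam β γ N).pow 2)).aestronglyMeasurable
  set H := (pinnedChain ω₂ lam β γ).hamiltonian N x with hH
  have hH0 : 0 ≤ H := pinnedChain_hamiltonian_nonneg hω.le hl hβ γ N x
  have hsq := one_add_sq_le_exp hH0 hs
  rw [Real.norm_eq_abs, abs_of_nonneg (by positivity)]
  have hHsq : H ^ 2 ≤ (1 + H) ^ 2 := by nlinarith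
  have hexp : Real.exp (-H / T) * Real.exp (T⁻¹ / 2 * H) = Real.exp (-(T⁻¹ / 2 * H)) := by
    rw [← Real.exp_add]; congr 1; field_simp; ring
  calc Real.exp (-H / T) * H ^ 2 ≤ Real.exp (-H / T) * (2 * Real.exp (T⁻¹ / 2) / (T⁻¹ / 2) ^ 2 *
        Real.exp (T⁻¹ / 2 * H)) :=
        mul_le_mul_of_nonneg_left (hHsq.trans hsq) (Real.exp_pos _).le
    _ = 2 * Real.exp (T⁻¹ / 2) / (T⁻¹ / 2) ^ 2 * Real.exp (-(T⁻¹ / 2 * H)) := by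
        rw [← hexp]; ring

/-- **`lhs ≤ ℓ² ∫ H² e^{-H/T}`**: the second moment of the windowed block transport is bounded by a
STATIC Gibbs moment, uniformly in the window `τ`. -/
theorem lhs_le_sq_moment (γ : ℝ) (N : ℕ) {k₁ k₂ : ℕ} (hk : k₁ ≤ k₂) {T : ℝ} (hT : 0 < T) {τ : ℝ} (hτ : 0 ≤ τ) :
    lhs ω₂ lam β γ N k₁ k₂ T τ ≤ ((k₂ : ℝ) - k₁) ^ 2 *
      ∫ x, Real.exp (-((pinnedChain ω₂ lam β γ).hamiltonian N x) / T) *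
        ((pinnedChain ω₂ lam β γ).hamiltonian N x) ^ 2 ∂volume := by
  unfold lhs
  rw [integral_gibbsWeight, ← integral_const_mul]
  refine integral_mono_of_nonneg (Filter.Eventually.of_forall fun x => by positivity)
    ((integrable_hamiltonian_sq_mul_exp hω hl hβ γ N hT).const_mul _)
    (Filter.Eventually.of_forall fun x => ?_)
  have h := windowedTransport_sq_le hω hl hβ γ N hk T hτ x
  have he := (Real.exp_pos (-((pinnedChain ω₂ lam β γ).hamiltonian N x) / T)).le
  calc Real.exp (-((pinnedChain ω₂ lam β γ).hamiltonian N x) / T) * (windowedTransport ω₂ lam β γ N k₁ k₂ T τ x) ^ 2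
      ≤ Real.exp (-((pinnedChain ω₂ lam β γ).hamiltonian N x) / T) *
          (((k₂ : ℝ) - k₁) * (pinnedChain ω₂ lam β γ).hamiltonian N x) ^ 2 :=
        mul_le_mul_of_nonneg_left h he
    _ = ((k₂ : ℝ) - k₁) ^ 2 * (Real.exp (-((pinnedChain ω₂ lam β γ).hamiltonian N x) / T) *
          ((pinnedChain ω₂ lam β γ).hamiltonian N x) ^ 2) := by ring

/-- `Z > 0`. -/
theorem partitionZ_pos (γ : ℝ) (N : ℕ) {T : ℝ} (hT : 0 < T) : 0 < partitionZ ω₂ lam β γ N T :=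
  integral_exp_pos (pinnedChain_integrable_gibbsDensity hω hl hβ γ N hT)

/-- **The crux holds AT EACH FIXED `N`** (quantifiers `∃ C ∀ N` swapped to `∀ N ∃ C`), for the closed
pinned chain with `ω₂ > 0`, `lam, β ≥ 0` (so also in the HARMONIC corner) and ANY `γ, T > 0`:
`C_N = N · ∫H²e^{-H/T} / Z` works for every block and every window, because the windowed transport is
a bounded energy difference. Hence the ENTIRE content of `SubBallisticWindow` is the `N`-uniformity of
`C` — no finite computation can refute it, and large `τ` is harmless. -/
theorem windowBound_fixedN (γ : ℝ) {T : ℝ} (hT : 0 < T) (N : ℕ) :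
    ∃ C : ℝ, ∀ k₁ k₂ : ℕ, k₁ ≤ k₂ → k₂ + 1 ≤ N → ∀ τ : ℝ, 0 ≤ τ →
      WindowBound ω₂ lam β γ T C N k₁ k₂ τ := by
  set M₂ := ∫ x, Real.exp (-((pinnedChain ω₂ lam β γ).hamiltonian N x) / T) *
    ((pinnedChain ω₂ lam β γ).hamiltonian N x) ^ 2 ∂volume with hM₂
  set Z := partitionZ ω₂ lam β γ N T with hZ
  have hZpos : 0 < Z := partitionZ_pos hω hl hβ γ N hT
  have hM₂0 : 0 ≤ M₂ := integral_nonneg fun x => by positivity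
  refine ⟨N * M₂ / Z, fun k₁ k₂ hk hkN τ hτ => ?_⟩
  unfold WindowBound
  have h1 := lhs_le_sq_moment hω hl hβ γ N hk hT hτ
  rw [← hM₂] at h1
  rw [← hZ]
  have hℓ0 : (0 : ℝ) ≤ (k₂ : ℝ) - k₁ := by
    have : (k₁ : ℝ) ≤ k₂ := by exact_mod_cast hk
    linarith
  have hℓN : (k₂ : ℝ) - k₁ ≤ N := by
    have : (k₂ : ℝ) + 1 ≤ N := by exact_mod_cast hkN
    have : (0 : ℝ) ≤ k₁ := Nat.cast_nonneg _
    linarith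
  have key : ((k₂ : ℝ) - k₁) ^ 2 * M₂ ≤ N * M₂ / Z * (1 + τ) * ((k₂ : ℝ) - k₁) * Z := by
    rw [show (N : ℝ) * M₂ / Z * (1 + τ) * ((k₂ : ℝ) - k₁) * Z = N * (1 + τ) * (((k₂ : ℝ) - k₁) * M₂) by
      field_simp]
    have h2 : ((k₂ : ℝ) - k₁) ^ 2 * M₂ = ((k₂ : ℝ) - k₁) * (((k₂ : ℝ) - k₁) * M₂) := by ring
    rw [h2]
    refine mul_le_mul_of_nonneg_right ?_ (mul_nonneg hℓ0 hM₂0)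
    nlinarith
  exact h1.trans key

end Block


/-! ## §4 Load-bearing analysis (the part that is a theorem): `0 < γ` is decoration; §5–§6 see the header -/

section LoadBearing

/-- `SubBallisticWindow` with the bath-coupling hypothesis `0 < γ` DROPPED (γ ranges over all reals and the
constant may not depend on it). -/
def SubBallisticWindowWithoutGamma : Prop :=
  ∀ ω₂ lam β : ℝ, 0 < ω₂ → 0 < lam → 0 < β → ∀ T : ℝ, 0 < T → ∃ C : ℝ,
    ∀ γ : ℝ, ∀ N k₁ k₂ : ℕ, k₁ ≤ k₂ → k₂ + 1 ≤ N → ∀ τ : ℝ, 0 ≤ τ → WindowBound ω₂ lam β γ T C N k₁ k₂ τ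

/-- The window inequality does not see `γ` (the body only uses `H` and `j_i` of `pinnedChain ω₂ lam β γ`,
which are `γ`-free, and the closed kernels of `pinnedChain ω₂ lam β 0`). Definitional. -/
theorem windowBound_gamma_irrel (ω₂ lam β γ γ' T C : ℝ) (N k₁ k₂ : ℕ) (τ : ℝ) :
    WindowBound ω₂ lam β γ T C N k₁ k₂ τ ↔ WindowBound ω₂ lam β γ' T C N k₁ k₂ τ := Iff.rfl

/-- **`hγ : 0 < γ` is pure decoration**: the crux is equivalent to its `γ`-free form. (So `0 < γ` is NOT
load-bearing; neither is it harmful.) -/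
theorem subBallisticWindow_iff_withoutGamma : SubBallisticWindow ↔ SubBallisticWindowWithoutGamma := by
  constructor
  · intro h ω₂ lam β hω hl hβ T hT
    obtain ⟨C, hC⟩ := h ω₂ lam β 1 hω hl hβ one_pos T hT
    exact ⟨C, fun γ N k₁ k₂ hk hkN τ hτ =>
      (windowBound_gamma_irrel ω₂ lam β 1 γ T C N k₁ k₂ τ).mp (hC N k₁ k₂ hk hkN τ hτ)⟩
  · intro h ω₂ lam β γ hω hl hβ _ T hT
    obtain ⟨C, hC⟩ := h ω₂ lam β hω hl hβ T hT
    exact ⟨C, fun N k₁ k₂ hk hkN τ hτ => hC γ N k₁ k₂ hk hkN τ hτ⟩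

/-- `SubBallisticWindow` with the quantifiers `∃ C ∀ N` SWAPPED to `∀ N ∃ C` and the anharmonicity
hypotheses WEAKENED to `0 ≤ lam`, `0 ≤ β` — in the literal shape of the route decl. -/
def SubBallisticWindowFixedN : Prop :=
  ∀ ω₂ lam β γ : ℝ, 0 < ω₂ → 0 ≤ lam → 0 ≤ β → ∀ T : ℝ, 0 < T → ∀ N : ℕ, ∃ C : ℝ, ∀ (k₁ k₂ : ℕ), k₁ ≤ k₂ → k₂ + 1 ≤ N → ∀ τ : ℝ, 0 ≤ τ → let P := Literature.MathematicalPhysics.KineticTheory.HeatConduction.pinnedChain ω₂ lam β γ; let P₀ := Literature.MathematicalPhysics.KineticTheory.HeatConduction.pinnedChain ω₂ lam β 0; let μT : MeasureTheory.Measure (Literature.MathematicalPhysics.KineticTheory.HeatConduction.PhaseSpace N) := MeasureTheory.volume.withDensity (fun x : Literature.MathematicalPhysics.KineticTheory.HeatConduction.PhaseSpace N => ENNReal.ofReal (Real.exp (-(P.hamiltonian N x) / T))); let JB : Literature.MathematicalPhysics.KineticTheory.HeatConduction.PhaseSpace N → ℝ := fun z => ∑ i : Fin N, (if k₁ ≤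 i.val ∧ i.val < k₂ then P.bondCurrent N i z else 0); ∫ x, (∫ t in Set.Ioc (0 : ℝ) τ, (∫ y, JB y ∂(P₀.transitionKernel N T T t.toNNReal x))) ^ 2 ∂μT ≤ C * (1 + τ) * ((k₂ : ℝ) - k₁) * ∫ x, Real.exp (-(P.hamiltonian N x) / T) ∂MeasureTheory.volume

/-- **The swapped-quantifier crux is a THEOREM** (even in the harmonic corner `lam = β = 0`):
every route to `¬ SubBallisticWindow` must exhibit GROWTH IN `N` of `sup_{B,τ} ∫Q_B(τ)²dμ_T/((1+τ)ℓZ)`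
at fixed `(ω₂, lam, β, T)`; no single `N` can witness a refutation. -/
theorem subBallisticWindowFixedN_holds : SubBallisticWindowFixedN :=
  fun _ _ _ γ hω hl hβ _ hT N => windowBound_fixedN hω hl hβ γ hT N

/-- The crux trivially implies its fixed-`N` form (restricted to `lam, β > 0`); the converse —
`N`-uniformity of `C` — is the whole open content. -/
theorem subBallisticWindow_fixedN_of_crux (h : SubBallisticWindow) :
    ∀ ω₂ lam β γ : ℝ, 0 < ω₂ → 0 < lam → 0 < β → 0 < γ → ∀ T : ℝ, 0 < T → ∀ N : ℕ, ∃ C : ℝ,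
      ∀ k₁ k₂ : ℕ, k₁ ≤ k₂ → k₂ + 1 ≤ N → ∀ τ : ℝ, 0 ≤ τ → WindowBound ω₂ lam β γ T C N k₁ k₂ τ :=
  fun ω₂ lam β γ hω hl hβ hγ T hT N =>
    let ⟨C, hC⟩ := h ω₂ lam β γ hω hl hβ hγ T hT
    ⟨C, fun k₁ k₂ hk hkN τ hτ => hC N k₁ k₂ hk hkN τ hτ⟩

end LoadBearing


/-! ## §7 Why it resists (cycle 1)

1. **No junk lever, no finite-`N` lever** (§1, §3): the objects are honest and the swapped-quantifier statement is
   PROVED; a counterexample is necessarily an `N → ∞` family at fixed `(ω₂, lam, β, T)` with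
   `sup_{B,τ} ∫Q_B(τ)²dμ_T / ((1+τ)(k₂-k₁)Z) → ∞`, i.e. a ballistic or superdiffusive channel in the EQUILIBRIUM
   energy-current fluctuations of the CLOSED pinned anharmonic chain.
2. **No such channel is known.**  Momentum is not conserved (pinning), so the KPZ/Lévy anomaly of FPU-type chains
   (`Literature.Barriers.AtomisticToContinuum.FPUBetaKineticAnomaly`, UNPINNED) does not apply; the phonon Boltzmann
   equation of the pinned weakly anharmonic chain has a finite conductivity (Aoki–Lukkarinen–Spohn 2006; the tree's
   `PinnedChainCollisionOperator`); equilibrium energy-fluctuation spreading in φ⁴-type (pinned) lattices is observed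
   DIFFUSIVE while FPU is superdiffusive (H. Zhao, PRL 96 (2006) 140602; Chen–Zhang–Wang–Zhao PRE 87 (2013) 032153 —
   cited from memory, `lit search` was unavailable this cycle, rc 75); Mazur/Drude weight is identically zero on the
   free-end chain at every `N` (`MazurBoundBallisticOpenChain`: `J = {H, X}`; here blockwise `J_B = {H, W_B}`, §3).
   Rare cold (quasi-harmonic, locally ballistic) corridors of length `L` cost `e^{-cL}` under `μ_T` and cannot change
   the `N`-scaling; hot spots / discrete breathers are immobile and only REDUCE current fluctuations
   (`Var Q_B = 2[Var W_B - Cov(W_B, W_B∘Φ_τ)]`, trapped energy keeps the covariance up).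
3. **What a prover faces** is exactly "κ_GK(T) < ∞ uniformly in the volume, windowed form" for a deterministic
   anharmonic lattice — open (Bonetto–Lebowitz–Rey-Bellet 2000 §6.3; Lepri–Livi–Politi 2003 §6), honestly tagged
   `open-problem` by the planner.  Fluctuating hydrodynamics predicts the bound with `C ≈ 2κ(T)T²` in both regimes
   `ℓ ≶ √(Dτ)` (ramp-weight computation: `Var Q_B(τ) ≈ c_T E∑_k (w_k - w_{k+X_τ})²`, `X_τ ∼ N(0,2Dτ)`, giving
   `≈ 2κT²ℓτ` for `ℓ ≫ √(Dτ)` and `≈ c_Tℓ²√(4Dτ/π) ≤ 2κT²ℓτ/√π·…` for `ℓ ≪ √(Dτ)`; saturation at the Thouless time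
   `τ ≍ N²/D` at `2c_T N·Var_k(w) ≍ N³` for central blocks, admissible since then `(1+τ)ℓ ≍ N³` too).
4. **Where a refuter should look next** (cycle 2): (a) the numerics of §6 at LOW `T` and LARGE `N` for a residual
   `N`-drift of `sup_τ R` beyond the kinetic plateau; (b) the `T → ∞` quartic scaling regime (chaotic but with
   FPU-β-like quartic solitary pulses on top of quartic pinning?) — a mobile high-energy excitation with range growing
   faster than `e^{E/T}` decays would break `N`-uniformity logarithmically; (c) the lead's stubs once a line is
   picked (`payload.targets`).
-/

end Summit.AtomisticToContinuum.FouriersLaw.Cruxes.SubBallisticWindow.Disproof
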